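import Mathlib
import HarnessLib
import Summits.AtomisticToContinuum.FouriersLaw.Theses.JunctionLocality
import Literature.MathematicalPhysics.KineticTheory.LangevinChainGibbs
import Literature.Analysis.Hypoelliptic.HormanderProof
import Summits.AtomisticToContinuum.FouriersLaw.Theorems.JunctionLocalitySuperadditiveResistancePlainAdjoint

/-!
# The plain chain at equilibrium, VII: uniqueness of the `L²(μ_T)` weak response field

Part VII (last) of the helper development (`--supports` stmt-AtomisticToContinuum-11748) for stub
`stub_linearResponse` of the line `thermalise-then-cut-probe-insertion` (crux
`JunctionLocality.SuperadditiveResistance`). It proves clause 2 of the line's `PlainFrame`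
(uniqueness a.e. of the first-order NESS density among ALL `L²(μ_T)` weak solutions tested on
`C_c^∞`), unconditionally (axioms `propext`, `Classical.choice`, `Quot.sound`):

* `exists_smooth_ae_eq_of_weak` — hypoelliptic regularity: for `pinnedChain ω₂ lam β γ`
  (`γ, T > 0`, `β ≥ 0`, `L ≥ 1`) a locally integrable `F` with `∫ (L_T φ) F dx = 0` for all
  `φ ∈ C_c^∞` agrees a.e. with a smooth function. This is Hörmander's Theorem 1.1 — PROVED in the
  tree (`Literature.Analysis.Hypoelliptic.hormander1967_thm11_proof`) — applied to the distribution
  `F dx` and the Fokker–Planck operator `L_T^* = X_L² + X_R² − Y + 2γ`, whose formal transpose is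
  `L_T` (`hormanderTranspose_eq_generator`) and which satisfies the bracket condition everywhere
  (`isBracketGenerating_hormanderFamily`, CEHR 2018 Prop. 4.1, `V″ = 1 + 3βr² > 0`), both in the
  tree; plus Mathlib's fundamental lemma of the calculus of variations.
* `plainResponseField_unique` — for `ω₂, γ, T > 0`, `lam, β ≥ 0`, `L ≥ 1`: two mean-zero
  `L²(μ_T)` functions with the same weak image `f ↦ ∫ (L_T f) h dμ_T` on `C_c^∞` coincide
  `μ_T`-a.e. Proof: `w = h′ − h ⊥ L_T(C_c^∞)`; `wρ_T` is a.e. a smooth `g` (previous item);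
  `w̃ = g/ρ_T ∈ C^∞ ∩ L²(μ_T)` solves the classical adjoint equation `−X_H w̃ + γ S w̃ = 0`
  (Part VI, `integral_generator_mul_eq_adjoint`, and the fundamental lemma), hence vanishes by the
  `L²(μ_T)`-Liouville theorem of Part V (`eq_zero_of_liouville_pinnedChain`, `σ = −1`). So the
  uniqueness clause of `PlainFrame` is a theorem ("is `(L_T, C_c^∞)` `L²(μ_T)`-unique?" — yes).
-/

noncomputable section

open MeasureTheory Filter Topology ProbabilityTheory
open scoped ContDiff NNReal
open Literature.MathematicalPhysics.KineticTheory.HeatConduction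

namespace Summit.AtomisticToContinuum.FouriersLaw.Theorems.SuperadditiveResistance.DeviceLiouville

section PlainUnique

open Literature.Analysis.Distribution Distributions

variable {ω₂ lam β : ℝ}

/-- **Hypoelliptic regularity of `L²`-weak solutions of the stationary adjoint equation** (from
Hörmander's theorem, PROVED in the tree, and the chain's bracket condition, CEHR Prop. 4.1): for
the pinned chain with `ω₂, γ, T > 0`, `lam, β ≥ 0`, `L ≥ 1`, a locally integrable `F` with
`∫ (L_T φ) F dx = 0` for all `φ ∈ C_c^∞` agrees a.e. with a smooth function. [folklore] -/
theorem exists_smooth_ae_eq_of_weak (hβ : 0 ≤ β) {γ : ℝ} (hγ : 0 < γ) {L : ℕ} (hL : 0 < L)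
    {T : ℝ} (hT : 0 < T) {F : PhaseSpace L → ℝ} (hF : LocallyIntegrable F volume)
    (hweak : ∀ φ : PhaseSpace L → ℝ, ContDiff ℝ ∞ φ → HasCompactSupport φ →
      ∫ x, φ x * 0 + (pinnedChain ω₂ lam β γ).generator L T T φ x * F x = 0) :
    ∃ g : PhaseSpace L → ℝ, ContDiff ℝ ∞ g ∧ F =ᵐ[volume] g := by
  haveI := isAddHaarMeasure_volume_phaseSpace L
  set P := pinnedChain ω₂ lam β γ with hP
  have hU : ContDiff ℝ ∞ P.U := pinnedChain_contDiff_U ω₂ lam β γ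
  have hV : ContDiff ℝ ∞ P.V := pinnedChain_contDiff_V ω₂ lam β γ
  have hγ' : P.γ = γ := rfl
  have hγT : 0 < P.γ * T := by rw [hγ']; positivity
  have hV2 : ∀ r, deriv (deriv P.V) r ≠ 0 := fun r => by
    rw [hP, pinnedChain_deriv_deriv_V]; positivity
  have hFloc : LocallyIntegrableOn F ((⊤ : TopologicalSpace.Opens (PhaseSpace L)) : Set (PhaseSpace L))
      volume := hF.locallyIntegrableOn _
  let u : 𝓓'((⊤ : TopologicalSpace.Opens (PhaseSpace L)), ℝ) :=
    (TestFunction.integralAgainstBilinCLM (ContinuousLinearMap.mul ℝ ℝ) volume F :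
      𝓓((⊤ : TopologicalSpace.Opens (PhaseSpace L)), ℝ) →L[ℝ] ℝ)
  have hu : ∀ φ : 𝓓((⊤ : TopologicalSpace.Opens (PhaseSpace L)), ℝ), u φ = ∫ x, φ x * F x := by
    intro φ
    change TestFunction.integralAgainstBilinCLM (ContinuousLinearMap.mul ℝ ℝ) volume F φ = _
    rw [TestFunction.integralAgainstBilinCLM_eq_integral hFloc]
    simp
  have hyp := Literature.Analysis.Hypoelliptic.hormander1967_thm11_proof (PhaseSpace L) volume (Fin 2) ⊤
    (P.adjointDrift L) (P.bathField hL T T) (fun _ => 2 * P.γ) (P.contDiff_adjointDrift hU hV L)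
    (fun _ => contDiff_const) contDiff_const
    (P.isBracketGenerating_hormanderFamily hL T T hU hV hγT hV2)
  have himg : ImageIsSmoothOn u (hormanderTranspose (P.adjointDrift L) (P.bathField hL T T)
      (fun _ => 2 * P.γ)) volume Set.univ := by
    refine ⟨0, contDiffOn_const, fun φ ψ _ hψ => ?_⟩
    rw [hu]
    simp only [Pi.zero_apply, zero_mul, integral_zero]
    have h1 : (fun x => ψ x) = hormanderTranspose (P.adjointDrift L) (P.bathField hL T T)
        (fun _ => 2 * P.γ) φ := hψ
    have h2 := hweak φ φ.contDiff φ.hasCompactSupport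
    simp only [mul_zero, zero_add] at h2
    rw [show (∫ x, ψ x * F x) = ∫ x, (fun x => ψ x) x * F x from rfl, h1,
      P.hormanderTranspose_eq_generator hU hV hL hγT.le hγT.le φ.contDiff]
    exact h2
  obtain ⟨g, hg, hgint⟩ := hyp u Set.univ isOpen_univ (Set.subset_univ _) himg
  refine ⟨g, contDiffOn_univ.mp hg, ?_⟩
  have hgloc : LocallyIntegrable g volume := (contDiffOn_univ.mp hg).continuous.locallyIntegrable
  refine ae_eq_of_integral_contDiff_smul_eq hF hgloc fun φ hφ hφc => ?_
  let Φ : 𝓓((⊤ : TopologicalSpace.Opens (PhaseSpace L)), ℝ) := ⟨φ, hφ, hφc, by simp⟩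
  have e1 := hu Φ
  have e2 := hgint Φ (Set.subset_univ _)
  simp only [smul_eq_mul]
  rw [← show (fun x => Φ x * F x) = fun x => φ x * F x from rfl] at *
  calc ∫ x, φ x * F x = u Φ := (hu Φ).symm
    _ = ∫ x, g x * Φ x := e2
    _ = ∫ x, φ x * g x := integral_congr_ae (ae_of_all _ fun x => by show g x * φ x = φ x * g x; ring)


/-- **Uniqueness of the `L²(μ_T)` weak first-order response field of the plain chain
(`PlainFrame`, clause 2).** For `pinnedChain ω₂ lam β γ` with `ω₂, γ, T > 0`, `lam, β ≥ 0`,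
`L ≥ 1`: two mean-zero `L²(μ_T)` weak solutions `h, h′` of `L_T^† h = (source)` tested on
`C_c^∞` — `∫ (L_T f) h dμ_T = S f = ∫ (L_T f) h′ dμ_T` for all `f ∈ C_c^∞`, ANY right-hand side
`S` — agree `μ_T`-a.e. (the line's `IsPlainResponseField` has `S f = −∫ f W dμ_T`, so
`∀ h′, IsPlainResponseField P T L h′ → h′ =ᵐ[μ_T] h` follows by `obtain`). Proof: `w = h′ − h ⊥ L_T(C_c^∞)` in `L²(μ_T)`; `(wρ_T) dx` solves the Fokker–Planck
equation in `𝓓′`, hence is smooth (Hörmander + CEHR Prop. 4.1, both in the tree); its smooth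
representative `w̃` solves the classical `μ_T`-adjoint equation `−X_H w̃ + γ S w̃ = 0`
(`integral_generator_mul_eq_adjoint`), so it vanishes by the `L²(μ_T)`-Liouville theorem. [folklore] -/
theorem plainResponseField_unique (hω : 0 < ω₂) (hl : 0 ≤ lam) (hβ : 0 ≤ β) {γ : ℝ} (hγ : 0 < γ)
    {L : ℕ} (hL : 0 < L) {T : ℝ} (hT : 0 < T) (S : (PhaseSpace L → ℝ) → ℝ)
    {h h' : PhaseSpace L → ℝ}
    (hL2 : MemLp h 2 ((pinnedChain ω₂ lam β γ).gibbsMeasure L T))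
    (hmean : ∫ x, h x ∂((pinnedChain ω₂ lam β γ).gibbsMeasure L T) = 0)
    (hweak : ∀ f : PhaseSpace L → ℝ, ContDiff ℝ ∞ f → HasCompactSupport f →
      ∫ x, (pinnedChain ω₂ lam β γ).generator L T T f x * h x
        ∂((pinnedChain ω₂ lam β γ).gibbsMeasure L T) = S f)
    (hL2' : MemLp h' 2 ((pinnedChain ω₂ lam β γ).gibbsMeasure L T))
    (hmean' : ∫ x, h' x ∂((pinnedChain ω₂ lam β γ).gibbsMeasure L T) = 0)
    (hweak' : ∀ f : PhaseSpace L → ℝ, ContDiff ℝ ∞ f → HasCompactSupport f →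
      ∫ x, (pinnedChain ω₂ lam β γ).generator L T T f x * h' x
        ∂((pinnedChain ω₂ lam β γ).gibbsMeasure L T) = S f) :
    h' =ᵐ[(pinnedChain ω₂ lam β γ).gibbsMeasure L T] h := by
  have hU1 : ContDiff ℝ 1 (pinnedChain ω₂ lam β γ).U := pinnedChain_contDiff_U ω₂ lam β γ
  have hV1 : ContDiff ℝ 1 (pinnedChain ω₂ lam β γ).V := pinnedChain_contDiff_V ω₂ lam β γ
  have hHs : ContDiff ℝ ∞ ((pinnedChain ω₂ lam β γ).hamiltonian L) :=
    (pinnedChain ω₂ lam β γ).contDiff_hamiltonian (pinnedChain_contDiff_U ω₂ lam β γ)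
      (pinnedChain_contDiff_V ω₂ lam β γ) L
  have hρs : ContDiff ℝ ∞ ((pinnedChain ω₂ lam β γ).gibbsDensity L T) :=
    Real.contDiff_exp.comp (hHs.neg.div_const T)
  have hρpos : ∀ x, 0 < (pinnedChain ω₂ lam β γ).gibbsDensity L T x := fun x =>
    (pinnedChain ω₂ lam β γ).gibbsDensity_pos L T x
  have hρint : Integrable ((pinnedChain ω₂ lam β γ).gibbsDensity L T) :=
    pinnedChain_integrable_gibbsDensity hω hl hβ γ L hT
  haveI := pinnedChain_isProbabilityMeasure_gibbsMeasure hω hl hβ γ L hT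
  -- the difference w = h' - h
  have hwL2 : MemLp (fun x => h' x - h x) 2 ((pinnedChain ω₂ lam β γ).gibbsMeasure L T) := hL2'.sub hL2
  have hwint : Integrable (fun x => h' x - h x) ((pinnedChain ω₂ lam β γ).gibbsMeasure L T) :=
    hwL2.integrable one_le_two
  have hwmean : ∫ x, (fun x => h' x - h x) x ∂((pinnedChain ω₂ lam β γ).gibbsMeasure L T) = 0 := by
    simp only
    rw [integral_sub (hL2'.integrable one_le_two) (hL2.integrable one_le_two), hmean, hmean', sub_zero]
  have hwweak : ∀ f : PhaseSpace L → ℝ, ContDiff ℝ ∞ f → HasCompactSupport f →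
      ∫ x, (pinnedChain ω₂ lam β γ).generator L T T f x * (h' x - h x)
        ∂((pinnedChain ω₂ lam β γ).gibbsMeasure L T) = 0 := by
    intro f hf hfc
    have hf2 : ContDiff ℝ 2 f := hf.of_le (by norm_cast)
    obtain ⟨C, hC⟩ := (pinnedChain ω₂ lam β γ).exists_bound_generator hU1 hV1 L T T hf2 hfc
    have hgc := ((pinnedChain ω₂ lam β γ).continuous_generator hU1 hV1 L T T hf2).aestronglyMeasurable
      (μ := (pinnedChain ω₂ lam β γ).gibbsMeasure L T)
    have i1 : Integrable (fun x => (pinnedChain ω₂ lam β γ).generator L T T f x * h' x)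
        ((pinnedChain ω₂ lam β γ).gibbsMeasure L T) :=
      (hL2'.integrable one_le_two).bdd_mul hgc (ae_of_all _ hC)
    have i2 : Integrable (fun x => (pinnedChain ω₂ lam β γ).generator L T T f x * h x)
        ((pinnedChain ω₂ lam β γ).gibbsMeasure L T) :=
      (hL2.integrable one_le_two).bdd_mul hgc (ae_of_all _ hC)
    simp only [mul_sub]
    rw [integral_sub i1 i2, hweak' f hf hfc, hweak f hf hfc, sub_self]
  -- pass to Lebesgue measure: F = (h' - h) ρ
  have hFint : Integrable (fun x => (h' x - h x) * (pinnedChain ω₂ lam β γ).gibbsDensity L T x) := by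
    have h1 := hwint
    rw [OscillatorChain.gibbsMeasure_eq, integrable_tilted_iff hρint] at h1
    refine h1.congr (ae_of_all _ fun x => ?_)
    simp only [smul_eq_mul, OscillatorChain.exp_neg_hamiltonian_div]
    ring
  have hFweak : ∀ φ : PhaseSpace L → ℝ, ContDiff ℝ ∞ φ → HasCompactSupport φ →
      ∫ x, φ x * 0 + (pinnedChain ω₂ lam β γ).generator L T T φ x *
        ((h' x - h x) * (pinnedChain ω₂ lam β γ).gibbsDensity L T x) = 0 := by
    intro φ hφ hφc
    have e := hwweak φ hφ hφc
    rw [(pinnedChain ω₂ lam β γ).integral_gibbsMeasure] at e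
    have hZ : (∫ x, (pinnedChain ω₂ lam β γ).gibbsDensity L T x)⁻¹ ≠ 0 :=
      inv_ne_zero (integral_exp_pos hρint).ne'
    have e2 := (mul_eq_zero.mp e).resolve_left hZ
    simp only [mul_zero, zero_add]
    simpa [mul_assoc] using e2
  obtain ⟨g, hg, hFg⟩ := exists_smooth_ae_eq_of_weak hβ hγ hL hT hFint.locallyIntegrable hFweak
  -- the smooth representative
  have hwtC : ContDiff ℝ ∞ (fun x => g x / (pinnedChain ω₂ lam β γ).gibbsDensity L T x) :=
    hg.div hρs fun x => (hρpos x).ne'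
  have hwt2 : ContDiff ℝ 2 (fun x => g x / (pinnedChain ω₂ lam β γ).gibbsDensity L T x) :=
    hwtC.of_le (by norm_cast)
  have hae : (fun x => h' x - h x) =ᵐ[volume] fun x => g x / (pinnedChain ω₂ lam β γ).gibbsDensity L T x := by
    filter_upwards [hFg] with x hx
    rw [eq_div_iff (hρpos x).ne']
    exact hx
  have haeμ : (fun x => h' x - h x) =ᵐ[(pinnedChain ω₂ lam β γ).gibbsMeasure L T]
      fun x => g x / (pinnedChain ω₂ lam β γ).gibbsDensity L T x :=
    ((pinnedChain ω₂ lam β γ).gibbsMeasure_absolutelyContinuous L T).ae_eq hae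
  have hwtL2 : MemLp (fun x => g x / (pinnedChain ω₂ lam β γ).gibbsDensity L T x) 2
      ((pinnedChain ω₂ lam β γ).gibbsMeasure L T) := hwL2.ae_eq haeμ
  have hwtmean : ∫ x, (fun x => g x / (pinnedChain ω₂ lam β γ).gibbsDensity L T x) x
      ∂((pinnedChain ω₂ lam β γ).gibbsMeasure L T) = 0 := by
    rw [← integral_congr_ae haeμ]
    exact hwmean
  -- the classical adjoint equation
  have hpde : ∀ x, (-1) * liouvilleOp (pinnedChain ω₂ lam β γ) L
      (fun x => g x / (pinnedChain ω₂ lam β γ).gibbsDensity L T x) x +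
      γ * bathOp L (OscillatorChain.bathWeight L) T
        (fun x => g x / (pinnedChain ω₂ lam β γ).gibbsDensity L T x) x = 0 := by
    set wt : PhaseSpace L → ℝ := fun x => g x / (pinnedChain ω₂ lam β γ).gibbsDensity L T x with hwt
    have hRc : Continuous (fun x => (-liouvilleOp (pinnedChain ω₂ lam β γ) L wt x +
        (pinnedChain ω₂ lam β γ).γ * bathOp L (OscillatorChain.bathWeight L) T wt x) *
          (pinnedChain ω₂ lam β γ).gibbsDensity L T x) :=
      ((continuous_liouvilleOp _ hU1 hV1 (hwtC.of_le (by norm_cast))).neg.add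
        (continuous_const.mul (continuous_bathOp hwt2 _ _))).mul hρs.continuous
    have hR : ∀ f : PhaseSpace L → ℝ, ContDiff ℝ ∞ f → HasCompactSupport f →
        ∫ x, f x • ((-liouvilleOp (pinnedChain ω₂ lam β γ) L wt x +
          (pinnedChain ω₂ lam β γ).γ * bathOp L (OscillatorChain.bathWeight L) T wt x) *
            (pinnedChain ω₂ lam β γ).gibbsDensity L T x) = 0 := by
      intro f hf hfc
      simp only [smul_eq_mul]
      rw [← integral_generator_mul_eq_adjoint (pinnedChain ω₂ lam β γ) hU1 hV1 L hT.ne'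
        (hf.of_le (by norm_cast)) hfc hwt2]
      have e1 : (fun x => (pinnedChain ω₂ lam β γ).generator L T T f x *
          (wt x * (pinnedChain ω₂ lam β γ).gibbsDensity L T x)) =ᵐ[volume]
          fun x => (pinnedChain ω₂ lam β γ).generator L T T f x *
            ((h' x - h x) * (pinnedChain ω₂ lam β γ).gibbsDensity L T x) := by
        filter_upwards [hae] with x hx
        rw [hx]
      rw [integral_congr_ae e1]
      have e := hFweak f hf hfc
      simpa using e
    have hR0 := ae_eq_zero_of_integral_contDiff_smul_eq_zero hRc.locallyIntegrable hR
    have hRzero := (Continuous.ae_eq_iff_eq volume hRc continuous_const).mp hR0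
    intro x
    have hx := congr_fun hRzero x
    have hγ' : (pinnedChain ω₂ lam β γ).γ = γ := rfl
    simp only [mul_eq_zero, (hρpos x).ne', or_false, hγ'] at hx
    linarith
  -- the Liouville theorem with σ = -1
  have hB : ∀ i, 0 ≤ OscillatorChain.bathWeight L i := fun i => by
    unfold OscillatorChain.bathWeight
    split_ifs <;> norm_num
  have hB0 : 0 < OscillatorChain.bathWeight L ⟨0, hL⟩ := by
    unfold OscillatorChain.bathWeight
    simp only [if_true]
    split_ifs <;> norm_num
  have hzero := eq_zero_of_liouville_pinnedChain hω hl hβ γ hL hT (OscillatorChain.bathWeight L) hB hB0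
    (by norm_num : (-1 : ℝ) ≠ 0) hγ hwt2 hwtL2 hpde hwtmean
  have hfin : (fun x => h' x - h x) =ᵐ[(pinnedChain ω₂ lam β γ).gibbsMeasure L T] fun _ => 0 :=
    haeμ.trans (ae_of_all _ fun x => hzero x)
  filter_upwards [hfin] with x hx
  exact sub_eq_zero.mp hx


/-- Registered helper sub-goal `helper_plainResponseUnique` (= `plainResponseField_unique` in stub
form): uniqueness of the `L²(μ_T)` weak response field (PlainFrame, clause 2). [folklore] -/
theorem helper_plainResponseUnique : ∀ (ω₂ lam β γ : ℝ), 0 < ω₂ → 0 ≤ lam → 0 ≤ β → 0 < γ → ∀ (L : ℕ), 0 < L → ∀ (T : ℝ), 0 < T → ∀ (S : (PhaseSpace L → ℝ) → ℝ) (h h' : PhaseSpace L → ℝ), MemLp h 2 ((pinnedChain ω₂ lam β γ).gibbsMeasure L T) → ∫ x, h x ∂((pinnedChain ω₂ lam β γ).gibbsMeasure L T) = 0 → (∀ f : PhaseSpace L → ℝ, ContDiff ℝ ∞ f → HasCompactSupport f → ∫ x, (pinnedChain ω₂ lam β γ).generator L T T f x * h x ∂((pinnedChain ω₂ lam β γ).gibbsMeasure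 L T) = S f) → MemLp h' 2 ((pinnedChain ω₂ lam β γ).gibbsMeasure L T) → ∫ x, h' x ∂((pinnedChain ω₂ lam β γ).gibbsMeasure L T) = 0 → (∀ f : PhaseSpace L → ℝ, ContDiff ℝ ∞ f → HasCompactSupport f → ∫ x, (pinnedChain ω₂ lam β γ).generator L T T f x * h' x ∂((pinnedChain ω₂ lam β γ).gibbsMeasure L T) = S f) → h' =ᵐ[(pinnedChain ω₂ lam β γ).gibbsMeasure L T] h :=
  fun _ _ _ _ hω hl hβ hγ _ hL _ hT S _ _ hL2 hmean hweak hL2' hmean' hweak' =>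
    plainResponseField_unique hω hl hβ hγ hL hT S hL2 hmean hweak hL2' hmean' hweak'

end PlainUnique

end Summit.AtomisticToContinuum.FouriersLaw.Theorems.SuperadditiveResistance.DeviceLiouville

end
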